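import Summits.CriticalPhenomena.CardyFormulaZ2.Theorems.CardyIKTransportIKMixedBoxCrossingXorDefs
import Summits.CriticalPhenomena.CardyFormulaZ2.Theorems.CardyIKTransportIKMixedBoxCrossingXorStubIsoUniv
import Summits.CriticalPhenomena.CardyFormulaZ2.Theorems.CardyIKTransportIKMixedBoxCrossingStubHoneycombRSW

/-!
# Helper `isotropyFloor_empty` toward the stub `stub_isotropyFloor` (line `xor-rectangle-flip`,
# crux `IKMixedBoxCrossing`, stmt-CriticalPhenomena-5911)

Support file (`--supports stmt-CriticalPhenomena-5911`): the `S = ∅` (pure honeycomb) member of the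
ISOTROPY FLOOR `IsotropyFloor` of the line. SQUARES of every side `n ≥ 1` at every position are crossed
by black paths in BOTH directions with probability bounded below by a universal `m > 0`:

  `∃ m > 0, ∀ n ≥ 1, ∀ a b, m ≤ μIK.real (bLR ∅ a b n n) ∧ m ≤ μIK.real (bTB ∅ a b n n)`.

Proof.
* BRIDGE (definitional, `IsoUnivStub.real_bLR_eq_pLR` / `real_bTB_eq_pTB` of the sibling helper file
  `…XorStubIsoUniv`): the `Negative.*` gauge of `XorDefs` and the `PinnedDiagramExchange.*` gauge of the
  line `paired-mirror-exploration` are the same terms, so `μIK.real (bLR S a b w h) = pLR S a b w h` and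
  `μIK.real (bTB S a b w h) = pTB S a b w h` by `rfl`.
* SQUARES `n ≥ 2` (`HoneycombStub.pLR_empty`, `HoneycombStub.pTB_empty`): for the empty pattern every face
  is anti-diagonal, the model is site percolation on `𝕋` at `p = 1/2` (`stub_TriLawOfEmpty`), and both
  `pLR ∅ a b n n` and `pTB ∅ a b n n` equal `triLRCrossingProb half (n-1) (n-1)`; by width antitonicity
  (`triLRCrossingProb_anti_width`, `n - 1 ≤ 2(n-1) + 1`) this is at least the aspect-`2` value
  `triLRCrossingProb half (2(n-1)+1) (n-1) ≥ c` of `HoneycombStub.exists_rsw_const` (RSW on `𝕋`,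
  `tri_rsw_half_holds`).
* `n = 1`: in the bond reading the `1 × 1` box is crossed by every configuration, so both probabilities
  are `1` (`IsoUnivStub.real_bLR_one_one`, `real_bTB_one_one`).
Take `m := min c 1`.
-/

noncomputable section

namespace Summit.CriticalPhenomena.CardyFormulaZ2.Cruxes.IKMixedBoxCrossing.XorRectangleFlip

open MeasureTheory
open Literature.Probability.Percolation Literature.Probability.LatticeModels
open Summit.CriticalPhenomena.CardyFormulaZ2.Theorems.IKMixedBoxCrossing.Negative (Ω μIK)
open Summit.CriticalPhenomena.CardyFormulaZ2.Cruxes.IKMixedBoxCrossing.PairedMirrorExploration (pLR pTB)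
open Summit.CriticalPhenomena.CardyFormulaZ2.Cruxes.IKMixedBoxCrossing.PairedMirrorExploration.HoneycombStub
  (pLR_empty pTB_empty exists_rsw_const)
open IsoUnivStub (real_bLR_eq_pLR real_bTB_eq_pTB real_bLR_one_one real_bTB_one_one)

namespace IsoEmptyStub

/-! ## Squares of side `≥ 2` of the empty pattern -/

/-- `P_∅[LR((k+2) × (k+2))] = P_{1/2}(LR_𝕋(k+1, k+1))`. -/
theorem pLR_empty_square (a b : ℤ) (k : ℕ) :
    pLR ∅ a b (k + 2) (k + 2) = triLRCrossingProb half (k + 1) (k + 1) :=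
  pLR_empty a b k (k + 1)

/-- `P_∅[BT((k+2) × (k+2))] = P_{1/2}(LR_𝕋(k+1, k+1))`. -/
theorem pTB_empty_square (a b : ℤ) (k : ℕ) :
    pTB ∅ a b (k + 2) (k + 2) = triLRCrossingProb half (k + 1) (k + 1) :=
  pTB_empty a b (k + 1) k

/-- RSW floor for lattice squares: `∃ c > 0, ∀ k, c ≤ P_{1/2}(LR_𝕋(k+1, k+1))` (the aspect-`2`
parallelogram `[0, 2(k+1)+1] × [0, k+1]` is harder to cross, `HoneycombStub.exists_rsw_const`). -/
theorem exists_square_const : ∃ c : ℝ, 0 < c ∧ ∀ k : ℕ, c ≤ triLRCrossingProb half (k + 1) (k + 1) := by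
  obtain ⟨c, hc, hk⟩ := exists_rsw_const
  exact ⟨c, hc, fun k => (hk (k + 1)).trans (triLRCrossingProb_anti_width half (by omega) (k + 1))⟩

end IsoEmptyStub

open IsoEmptyStub in
/-- **Helper `isotropyFloor_empty`** (the `S = ∅` member of `IsotropyFloor`, toward `stub_isotropyFloor`):
squares of every side `n ≥ 1` at every position are crossed by black paths of the pure honeycomb member
in both directions with probability `≥ m > 0` — RSW on `𝕋` (`tri_rsw_half_holds`) through the law of the
empty pattern, and the sure crossing of the `1 × 1` box. -/
theorem isotropyFloor_empty : ∃ m : ℝ, 0 < m ∧ ∀ n : ℕ, 1 ≤ n → ∀ a b : ℤ,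
    m ≤ μIK.real (bLR ∅ a b n n) ∧ m ≤ μIK.real (bTB ∅ a b n n) := by
  obtain ⟨c, hc, hk⟩ := exists_square_const
  refine ⟨min c 1, lt_min hc one_pos, fun n hn a b => ?_⟩
  rcases Nat.lt_or_ge n 2 with hlt | hge
  · obtain rfl : n = 1 := by omega
    rw [Nat.cast_one, real_bLR_one_one, real_bTB_one_one]
    exact ⟨min_le_right _ _, min_le_right _ _⟩
  · obtain ⟨k, rfl⟩ : ∃ k, n = k + 2 := ⟨n - 2, by omega⟩
    rw [real_bLR_eq_pLR, real_bTB_eq_pTB, pLR_empty_square, pTB_empty_square]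
    exact ⟨(min_le_left _ _).trans (hk k), (min_le_left _ _).trans (hk k)⟩

end Summit.CriticalPhenomena.CardyFormulaZ2.Cruxes.IKMixedBoxCrossing.XorRectangleFlip

end
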